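import Mathlib.Tactic.Group
import Mathlib.Tactic.FinCases
import Mathlib.Algebra.Group.Conj
import Mathlib.GroupTheory.QuotientGroup.Basic
import Literature.Topology.FourManifolds.TriangularPresentationAndrewsCurtis
import HarnessLib

/-!
# The Akbulut–Kirby / Miller–Schupp / Shehper series are Andrews–Curtis equivalent — for all parameters

Topic `Literature/Topology/FourManifolds`.  A reproduction, as kernel-checked theorems valid for ALL
values of the parameters, of three published parametric Andrews–Curtis computations on the two-generator
balanced presentations of `Literature.Topology.FourManifolds.BalancedPresentation`:

* **Myasnikov–Myasnikov–Shpilrain 2002, Prop. 1.3**: the Akbulut–Kirby presentation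
  `AK(n) = ⟨x, y ∣ xⁿ = yⁿ⁺¹, xyx = yxy⟩` is Andrews–Curtis equivalent to the Miller–Schupp presentation
  `MS(n, w₁) = ⟨x, y ∣ x⁻¹yⁿx = yⁿ⁺¹, x = w₁⟩`, `w₁ = y⁻¹x⁻¹yxy`
  (`isAndrewsCurtisEquivalent_akbulutKirby_millerSchuppK_one`);
* **Shehper et al. 2025, Thm. 6**: for fixed `n`, the presentations `MS(n, w_k)`, `w_k = y⁻ᵏx⁻¹yxy`, `k ∈ ℤ`,
  are pairwise Andrews–Curtis equivalent (`isAndrewsCurtisEquivalent_millerSchuppK_succ`,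
  `isAndrewsCurtisEquivalent_millerSchuppK_millerSchuppK`);
* **Shehper et al. 2025, Thm. 7**: `MS(n, w_k)` is Andrews–Curtis equivalent to
  `P(n, k) = ⟨x, y ∣ yⁿ⁻ᵏ⁻¹x⁻¹yx = xyx⁻¹yⁿ⁻ᵏ, x = w_k⟩` (`isAndrewsCurtisEquivalent_millerSchuppK_shehperP`),
  whence (**Thm. 4** there) `AK(n)` is Andrews–Curtis equivalent to the length-`n + 11` presentation
  `⟨x, y ∣ x⁻¹yx = xyx⁻¹y, xyⁿ⁻¹x = yxy⟩` (`isAndrewsCurtisEquivalent_akbulutKirby_shehperT`).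

The published proofs are "substitution" arguments; here each substitution is the derived move
`rᵢ ↦ rᵢ · (c rⱼ^{±1} c⁻¹)` (`IsAndrewsCurtisEquivalent.update_mul_conj`) or, for the substitution
`x ↦ w₁` into `xⁿ` of MMS, multiplication of `r₀` by the consequence `r₀⁻¹ φ(r₀)` of `r₁`
(`IsAndrewsCurtisEquivalent.update_mul_of_mem_normalClosure`, with the kernel lemma
`inv_mul_lift_mem_of_forall_generator`), and every free-group identity between consecutive relators
is discharged by Mathlib's `group` tactic — so the statements hold uniformly in `n` and `k`, not
instance by instance (explicit finite certificates for small parameters are in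
`AndrewsCurtisCertificateRecords.lean`).  Consequence recorded for the 4-manifold side: every member of
these series is Andrews–Curtis equivalent to `AK(n)`, so its 5-dimensional thickening and the double of
any 4-dimensional thickening are standard exactly when those of `AK(n)` are (Gompf 1991 for `AK(n)`);
nothing here asserts that a homotopy 4-ball built from such a presentation is `B⁴`.

Sources: A. D. Myasnikov, A. G. Myasnikov, V. Shpilrain, *On the Andrews–Curtis equivalence*,
Contemp. Math. 296 (2002), Prop. 1.3 and its proof [cite: MyasnikovMyasnikovShpilrain2003];
A. Shehper et al., *What makes math problems hard for reinforcement learning: a case study*, 2025,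
§3.4–3.6, Thms. 4, 6, 7 and their proofs [cite: ShehperEtAl2025ACHardRL].
-/

namespace Literature.Topology.FourManifolds

open Function

/-! ### The presentations -/

/-- The Miller–Schupp presentation `MS(n, w_k) = ⟨x, y ∣ x⁻¹ yⁿ x = yⁿ⁺¹, x = w_k⟩` with
`w_k = y⁻ᵏ x⁻¹ y x y` (`k ∈ ℤ`; `w₁ = y⁻¹x⁻¹yxy` is the word of Myasnikov–Myasnikov–Shpilrain),
encoded by the relators `x⁻¹ yⁿ x y⁻⁽ⁿ⁺¹⁾` and `x w_k⁻¹`. [cite: ShehperEtAl2025ACHardRL, Thm 6] -/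
def millerSchuppK (n : ℕ) (k : ℤ) : BalancedPresentation 2 :=
  ![(FreeGroup.of 0)⁻¹ * FreeGroup.of 1 ^ n * FreeGroup.of 0 * (FreeGroup.of 1 ^ (n + 1))⁻¹,
    FreeGroup.of 0 *
      (FreeGroup.of 1 ^ (-k) * (FreeGroup.of 0)⁻¹ * FreeGroup.of 1 * FreeGroup.of 0 * FreeGroup.of 1)⁻¹]

/-- The presentation `P(n, k) = ⟨x, y ∣ yⁿ⁻ᵏ⁻¹ x⁻¹ y x = x y x⁻¹ yⁿ⁻ᵏ, x = w_k⟩` of Shehper et al.,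
of total length `|k| + |n − k| + |n − k − 1| + 11`. [cite: ShehperEtAl2025ACHardRL, Thm 7] -/
def shehperP (n : ℕ) (k : ℤ) : BalancedPresentation 2 :=
  ![FreeGroup.of 1 ^ ((n : ℤ) - k - 1) * (FreeGroup.of 0)⁻¹ * FreeGroup.of 1 * FreeGroup.of 0 *
      (FreeGroup.of 0 * FreeGroup.of 1 * (FreeGroup.of 0)⁻¹ * FreeGroup.of 1 ^ ((n : ℤ) - k))⁻¹,
    FreeGroup.of 0 *
      (FreeGroup.of 1 ^ (-k) * (FreeGroup.of 0)⁻¹ * FreeGroup.of 1 * FreeGroup.of 0 * FreeGroup.of 1)⁻¹]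

/-- The length-`n + 11` presentation `⟨x, y ∣ x⁻¹ y x = x y x⁻¹ y, x yⁿ⁻¹ x = y x y⟩` of Shehper et al.
(their Theorem 4; it is `P(n, n − 1)` up to a cyclic permutation of the second relator).
[cite: ShehperEtAl2025ACHardRL, Thm 4] -/
def shehperT (n : ℕ) : BalancedPresentation 2 :=
  ![(FreeGroup.of 0)⁻¹ * FreeGroup.of 1 * FreeGroup.of 0 *
      (FreeGroup.of 0 * FreeGroup.of 1 * (FreeGroup.of 0)⁻¹ * FreeGroup.of 1)⁻¹,
    FreeGroup.of 0 * FreeGroup.of 1 ^ ((n : ℤ) - 1) * FreeGroup.of 0 *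
      (FreeGroup.of 1 * FreeGroup.of 0 * FreeGroup.of 1)⁻¹]

/-! ### Elementary and derived moves on `![u, v]`, up to a free-group identity

Each move takes the new relator as an explicit argument together with a proof `h` that it equals the
result of the move; in the applications `h` is discharged by `group` (the identities involve symbolic
exponents `n`, `k`). -/

section Moves

variable {u v u' v' : FreeGroup (Fin 2)}

/-- Move `r₀ ↦ r₀⁻¹` on `![u, v]`. [cite: AndrewsCurtis1965PAMS] -/
theorem acPair_inv₀ (h : u' = u⁻¹) : IsAndrewsCurtisEquivalent ![u, v] ![u', v] := by
  convert IsAndrewsCurtisEquivalent.update_inv ![u, v] 0 using 2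
  ext i; fin_cases i <;> simp [h]

/-- Move `r₁ ↦ r₁⁻¹` on `![u, v]`. [cite: AndrewsCurtis1965PAMS] -/
theorem acPair_inv₁ (h : v' = v⁻¹) : IsAndrewsCurtisEquivalent ![u, v] ![u, v'] := by
  convert IsAndrewsCurtisEquivalent.update_inv ![u, v] 1 using 2
  ext i; fin_cases i <;> simp [h]

/-- Conjugation `r₀ ↦ c r₀ c⁻¹` by a word on `![u, v]`. [folklore] -/
theorem acPair_conj₀ (c : FreeGroup (Fin 2)) (h : u' = c * u * c⁻¹) :
    IsAndrewsCurtisEquivalent ![u, v] ![u', v] := by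
  convert IsAndrewsCurtisEquivalent.update_conj ![u, v] 0 c using 2
  ext i; fin_cases i <;> simp [h]

/-- Conjugation `r₁ ↦ c r₁ c⁻¹` by a word on `![u, v]`. [folklore] -/
theorem acPair_conj₁ (c : FreeGroup (Fin 2)) (h : v' = c * v * c⁻¹) :
    IsAndrewsCurtisEquivalent ![u, v] ![u, v'] := by
  convert IsAndrewsCurtisEquivalent.update_conj ![u, v] 1 c using 2
  ext i; fin_cases i <;> simp [h]

/-- Derived move `r₀ ↦ r₀ · (c r₁ c⁻¹)` ("substitute using `r₁` inside `r₀`").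
[cite: HogAngeloniMetzler1993, Ch. I §2.3] -/
theorem acPair_mulConj₀ (c : FreeGroup (Fin 2)) (h : u' = u * (c * v * c⁻¹)) :
    IsAndrewsCurtisEquivalent ![u, v] ![u', v] := by
  convert IsAndrewsCurtisEquivalent.update_mul_conj ![u, v] (i := 0) (j := 1) (by decide) c using 2
  ext i; fin_cases i <;> simp [h]

/-- Derived move `r₁ ↦ r₁ · (c r₀ c⁻¹)`. [cite: HogAngeloniMetzler1993, Ch. I §2.3] -/
theorem acPair_mulConj₁ (c : FreeGroup (Fin 2)) (h : v' = v * (c * u * c⁻¹)) :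
    IsAndrewsCurtisEquivalent ![u, v] ![u, v'] := by
  convert IsAndrewsCurtisEquivalent.update_mul_conj ![u, v] (i := 1) (j := 0) (by decide) c using 2
  ext i; fin_cases i <;> simp [h]

/-- Derived move `r₀ ↦ r₀ · (c r₁⁻¹ c⁻¹)` (invert `r₁`, substitute, invert back). [folklore] -/
theorem acPair_mulConjInv₀ (c : FreeGroup (Fin 2)) (h : u' = u * (c * v⁻¹ * c⁻¹)) :
    IsAndrewsCurtisEquivalent ![u, v] ![u', v] :=
  ((acPair_inv₁ (v' := v⁻¹) rfl).trans (acPair_mulConj₀ (v := v⁻¹) c h)).trans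
    (acPair_inv₁ (v' := v) (inv_inv v).symm)

/-- Derived move `r₁ ↦ r₁ · (c r₀⁻¹ c⁻¹)`. [folklore] -/
theorem acPair_mulConjInv₁ (c : FreeGroup (Fin 2)) (h : v' = v * (c * u⁻¹ * c⁻¹)) :
    IsAndrewsCurtisEquivalent ![u, v] ![u, v'] :=
  ((acPair_inv₀ (u' := u⁻¹) rfl).trans (acPair_mulConj₁ (u := u⁻¹) c h)).trans
    (acPair_inv₀ (u' := u) (inv_inv u).symm)

/-- Derived move `r₁ ↦ (c r₀ c⁻¹) · r₁` (left multiplication = right multiplication by the conjugate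
under `r₁⁻¹ c`). [folklore] -/
theorem acPair_conjMul₁ (c : FreeGroup (Fin 2)) (h : v' = (c * u * c⁻¹) * v) :
    IsAndrewsCurtisEquivalent ![u, v] ![u, v'] :=
  acPair_mulConj₁ (v⁻¹ * c) (by rw [h]; group)

/-- Derived move `r₁ ↦ (c r₀⁻¹ c⁻¹) · r₁`. [folklore] -/
theorem acPair_conjMulInv₁ (c : FreeGroup (Fin 2)) (h : v' = (c * u⁻¹ * c⁻¹) * v) :
    IsAndrewsCurtisEquivalent ![u, v] ![u, v'] :=
  acPair_mulConjInv₁ (v⁻¹ * c) (by rw [h]; group)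

end Moves

/-! ### The kernel of a substitution

If an endomorphism `φ` of the free group moves every generator within its coset of a normal subgroup
`N` (`xᵢ⁻¹ φ(xᵢ) ∈ N`), then `g⁻¹ φ(g) ∈ N` for every `g`: `φ` and the identity agree after passing to
`F/N`.  With `N` the normal closure of the other relators this makes "substitute `x ↦ w` everywhere in
`r₀` using the relator `x w⁻¹`" a sequence of Andrews–Curtis moves. -/

/-- `g⁻¹ · φ g ∈ N` for all `g`, as soon as this holds for the generators. [folklore] -/
theorem inv_mul_lift_mem_of_forall_generator {m : ℕ} (f : Fin m → FreeGroup (Fin m))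
    (N : Subgroup (FreeGroup (Fin m))) [hN : N.Normal]
    (hf : ∀ i, (FreeGroup.of i)⁻¹ * f i ∈ N) (g : FreeGroup (Fin m)) :
    g⁻¹ * FreeGroup.lift f g ∈ N := by
  have key : (QuotientGroup.mk' N).comp (FreeGroup.lift f) = QuotientGroup.mk' N := by
    ext i
    simp only [MonoidHom.coe_comp, Function.comp_apply, FreeGroup.lift_apply_of, QuotientGroup.mk'_apply]
    exact (QuotientGroup.eq.2 (hf i)).symm
  have hg := DFunLike.congr_fun key g
  simp only [MonoidHom.coe_comp, Function.comp_apply, QuotientGroup.mk'_apply] at hg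
  exact QuotientGroup.eq.1 hg.symm

/-! ### MMS Prop. 1.3: `AK(n) ~ MS(n, w₁)` -/

/-- **Myasnikov–Myasnikov–Shpilrain 2002, Prop. 1.3: `AK(n)` is Andrews–Curtis equivalent to
`MS(n, w₁)`, `w₁ = y⁻¹x⁻¹yxy`** (`n = k + 2 ≥ 2`; the argument works verbatim for every `n`).  Proof as
published: rewrite `xyx = yxy` as `x = w₁` (a cyclic permutation of the relator), substitute `x ↦ w₁`
in `xⁿ` — `w₁ⁿ = y⁻¹x⁻¹yⁿxy`, the substitution being multiplication of `r₀` by the consequence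
`r₀⁻¹ φ(r₀)` of `r₁` — and conjugate by `y`. [cite: MyasnikovMyasnikovShpilrain2003, Prop 1.3] -/
theorem isAndrewsCurtisEquivalent_akbulutKirby_millerSchuppK_one (k : ℕ) :
    IsAndrewsCurtisEquivalent (akbulutKirby k) (millerSchuppK (k + 2) 1) := by
  set x : FreeGroup (Fin 2) := FreeGroup.of 0 with hx
  set y : FreeGroup (Fin 2) := FreeGroup.of 1 with hy
  -- the word `w₁` and the relator `v = x w₁⁻¹`
  set w : FreeGroup (Fin 2) := y⁻¹ * x⁻¹ * y * x * y with hw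
  set v : FreeGroup (Fin 2) := x * w⁻¹ with hv
  have e : akbulutKirby k = ![x ^ (k + 2) * (y ^ (k + 3))⁻¹, x * y * x * (y * x * y)⁻¹] := rfl
  have fin : millerSchuppK (k + 2) 1 =
      ![x⁻¹ * y ^ (k + 2) * x * (y ^ (k + 2 + 1))⁻¹, x * (y ^ (-(1 : ℤ)) * x⁻¹ * y * x * y)⁻¹] := rfl
  rw [e, fin]
  -- Step 1: `r₁ = xyx(yxy)⁻¹ ↦ v = x y⁻¹ x⁻¹ y⁻¹ x y`, a cyclic permutation.
  refine (acPair_conj₁ ((x * y)⁻¹) (v' := v) (by rw [hv, hw]; group)).trans ?_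
  -- Step 2: substitute `x ↦ w₁` in `r₀`: multiply `r₀` by `r₀⁻¹ φ(r₀) ∈ ⟪v⟫`.
  set φ : FreeGroup (Fin 2) →* FreeGroup (Fin 2) := FreeGroup.lift ![w, y] with hφ
  set r₀ : FreeGroup (Fin 2) := x ^ (k + 2) * (y ^ (k + 3))⁻¹ with hr₀
  have hmem : r₀⁻¹ * φ r₀ ∈ Subgroup.normalClosure ((![r₀, v] : BalancedPresentation 2) '' {1}) := by
    have hS : ((![r₀, v] : BalancedPresentation 2) '' {1}) = {v} := by
      rw [Set.image_singleton]; rfl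
    rw [hS]
    haveI : (Subgroup.normalClosure ({v} : Set (FreeGroup (Fin 2)))).Normal :=
      Subgroup.normalClosure_normal
    refine inv_mul_lift_mem_of_forall_generator ![w, y] _ (Fin.forall_fin_two.2 ⟨?_, ?_⟩) r₀
    · -- `x⁻¹ w₁ = x⁻¹ v⁻¹ x`, a conjugate of `v⁻¹`
      have hvmem : v ∈ Subgroup.normalClosure ({v} : Set (FreeGroup (Fin 2))) :=
        Subgroup.subset_normalClosure rfl
      have e₁ : (FreeGroup.of (0 : Fin 2))⁻¹ * (![w, y] : Fin 2 → FreeGroup (Fin 2)) 0 =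
          x⁻¹ * v⁻¹ * x⁻¹⁻¹ := by
        simp only [Matrix.cons_val_zero]; rw [hv, ← hx]; group
      rw [e₁]
      exact Subgroup.Normal.conj_mem inferInstance _ (Subgroup.inv_mem _ hvmem) _
    · have e₁ : (FreeGroup.of (1 : Fin 2))⁻¹ * (![w, y] : Fin 2 → FreeGroup (Fin 2)) 1 = 1 := by
        simp only [Matrix.cons_val_one, Matrix.cons_val_zero]; rw [← hy]; group
      rw [e₁]
      exact Subgroup.one_mem _
  have step := IsAndrewsCurtisEquivalent.update_mul_of_mem_normalClosure
    (![r₀, v] : BalancedPresentation 2) (i := 0) (S := {1}) (by decide) hmem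
  have eupd : update (![r₀, v] : BalancedPresentation 2) 0
      ((![r₀, v] : BalancedPresentation 2) 0 * (r₀⁻¹ * φ r₀)) = ![φ r₀, v] := by
    ext i; fin_cases i <;> simp
  rw [eupd] at step
  refine step.trans ?_
  -- `φ(r₀) = w₁ⁿ y⁻⁽ⁿ⁺¹⁾ = y⁻¹ x⁻¹ yⁿ x y · y⁻⁽ⁿ⁺¹⁾`
  have hφr : φ r₀ = y⁻¹ * x⁻¹ * y ^ (k + 2) * x * y * (y ^ (k + 3))⁻¹ := by
    have hφx : φ x = w := by rw [hφ, hx, FreeGroup.lift_apply_of]; rfl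
    have hφy : φ y = y := by rw [hφ, hy, FreeGroup.lift_apply_of]; rfl
    rw [hr₀, map_mul, map_inv, map_pow, map_pow, hφx, hφy]
    have hw' : w = (y⁻¹ * x⁻¹) * y * (y⁻¹ * x⁻¹)⁻¹ := by rw [hw]; group
    rw [hw', conj_pow]
    group
  rw [hφr]
  -- Step 3: conjugate `r₀` by `y`.
  refine (acPair_conj₀ y (u' := x⁻¹ * y ^ (k + 2) * x * (y ^ (k + 2 + 1))⁻¹) (by group)).trans ?_
  have hv' : v = x * (y ^ (-(1 : ℤ)) * x⁻¹ * y * x * y)⁻¹ := by rw [hv, hw]; group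
  rw [hv']
  exact IsAndrewsCurtisEquivalent.refl _

/-! ### Shehper et al. Thm. 6: `MS(n, w_k) ~ MS(n, w_{k+1})` -/

/-- **Shehper et al. 2025, Thm. 6 (one step): `MS(n, w_k)` is Andrews–Curtis equivalent to
`MS(n, w_{k+1})`**, for every `n : ℕ` and `k : ℤ`.  The published proof, move by move: rotate `r₁` to
`yᵏxy⁻¹(x⁻¹yx)⁻¹`; substitute (i) `yᵏxy⁻¹ = yᵏ⁻ⁿxyⁿ` (insert a conjugate of `r₀⁻¹`); rewrite as
`yxy⁻ⁿ = xyᵏ⁻ⁿx` (invert, rotate); substitute (ii) `y⁻⁽ⁿ⁻¹⁾xy = yxy⁻ⁿ` (a conjugate of `r₀⁻¹` on the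
left); rewrite as `yⁿ⁻ᵏx⁻¹y⁻⁽ⁿ⁻¹⁾ = xy⁻¹x⁻¹` (rotate); substitute (iii) `yⁿ⁻ᵏx⁻¹y⁻⁽ⁿ⁻¹⁾ = y⁻⁽ᵏ⁺¹⁾x⁻¹y`
(a conjugate of `r₀` on the left); invert: `x = w_{k+1}`. [cite: ShehperEtAl2025ACHardRL, Thm 6] -/
theorem isAndrewsCurtisEquivalent_millerSchuppK_succ (n : ℕ) (k : ℤ) :
    IsAndrewsCurtisEquivalent (millerSchuppK n k) (millerSchuppK n (k + 1)) := by
  set x : FreeGroup (Fin 2) := FreeGroup.of 0 with hx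
  set y : FreeGroup (Fin 2) := FreeGroup.of 1 with hy
  set R : FreeGroup (Fin 2) := x⁻¹ * y ^ n * x * (y ^ (n + 1))⁻¹ with hR
  have e : millerSchuppK n k = ![R, x * (y ^ (-k) * x⁻¹ * y * x * y)⁻¹] := rfl
  have fin : millerSchuppK n (k + 1) = ![R, x * (y ^ (-(k + 1)) * x⁻¹ * y * x * y)⁻¹] := rfl
  rw [e, fin]
  -- ρ₁ = yᵏ x y⁻¹ x⁻¹ y⁻¹ x
  refine (acPair_conj₁ (y ^ k) (v' := y ^ k * x * y⁻¹ * x⁻¹ * y⁻¹ * x) (by group)).trans ?_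
  -- (i): ρ₂ = yᵏ⁻ⁿ x yⁿ x⁻¹ y⁻¹ x = ρ₁ · D R⁻¹ D⁻¹,  D = x⁻¹ y x y⁻ⁿ
  refine (acPair_mulConjInv₁ (x⁻¹ * y * x * y ^ (-(n : ℤ)))
    (v' := y ^ (k - n) * x * y ^ (n : ℤ) * x⁻¹ * y⁻¹ * x) (by rw [hR]; group)).trans ?_
  -- invert and rotate: ρ₃ = y x y⁻ⁿ x⁻¹ yⁿ⁻ᵏ x⁻¹
  refine (acPair_inv₁ (v' := x⁻¹ * y * x * y ^ (-(n : ℤ)) * x⁻¹ * y ^ ((n : ℤ) - k)) (by group)).trans ?_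
  refine (acPair_conj₁ x (v' := y * x * y ^ (-(n : ℤ)) * x⁻¹ * y ^ ((n : ℤ) - k) * x⁻¹)
    (by group)).trans ?_
  -- (ii): ρ₄ = y¹⁻ⁿ x y x⁻¹ yⁿ⁻ᵏ x⁻¹ = (E R⁻¹ E⁻¹) ρ₃,  E = y¹⁻ⁿ x
  refine (acPair_conjMulInv₁ (y ^ (1 - (n : ℤ)) * x)
    (v' := y ^ (1 - (n : ℤ)) * x * y * x⁻¹ * y ^ ((n : ℤ) - k) * x⁻¹) (by rw [hR]; group)).trans ?_
  -- rotate: ρ₅ = yⁿ⁻ᵏ x⁻¹ y¹⁻ⁿ x y x⁻¹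
  refine (acPair_conj₁ (x * y⁻¹ * x⁻¹ * y ^ ((n : ℤ) - 1))
    (v' := y ^ ((n : ℤ) - k) * x⁻¹ * y ^ (1 - (n : ℤ)) * x * y * x⁻¹) (by group)).trans ?_
  -- (iii): ρ₆ = y⁻⁽ᵏ⁺¹⁾ x⁻¹ y x y x⁻¹ = (G R G⁻¹) ρ₅,  G = y⁻⁽ᵏ⁺¹⁾
  refine (acPair_conjMul₁ (y ^ (-(k + 1)))
    (v' := y ^ (-(k + 1)) * x⁻¹ * y * x * y * x⁻¹) (by rw [hR]; group)).trans ?_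
  -- invert: x w_{k+1}⁻¹
  exact acPair_inv₁ (by group)

/-- `MS(n, w_k) ~ MS(n, w_{k+m})`. [cite: ShehperEtAl2025ACHardRL, Thm 6] -/
theorem isAndrewsCurtisEquivalent_millerSchuppK_add (n : ℕ) (k : ℤ) (m : ℕ) :
    IsAndrewsCurtisEquivalent (millerSchuppK n k) (millerSchuppK n (k + m)) := by
  induction m with
  | zero => simpa using IsAndrewsCurtisEquivalent.refl (millerSchuppK n k)
  | succ m ih =>
    have e : k + ((m + 1 : ℕ) : ℤ) = (k + m) + 1 := by push_cast; ring
    rw [e]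
    exact ih.trans (isAndrewsCurtisEquivalent_millerSchuppK_succ n (k + m))

/-- **Shehper et al. 2025, Thm. 6: for fixed `n` the presentations `MS(n, w_k)`, `k ∈ ℤ`, are pairwise
Andrews–Curtis equivalent.** [cite: ShehperEtAl2025ACHardRL, Thm 6] -/
theorem isAndrewsCurtisEquivalent_millerSchuppK_millerSchuppK (n : ℕ) (k k' : ℤ) :
    IsAndrewsCurtisEquivalent (millerSchuppK n k) (millerSchuppK n k') := by
  rcases le_or_gt k k' with h | h
  · have e : k' = k + ((k' - k).toNat : ℕ) := by rw [Int.toNat_of_nonneg (sub_nonneg.2 h)]; ring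
    rw [e]; exact isAndrewsCurtisEquivalent_millerSchuppK_add n k _
  · have e : k = k' + ((k - k').toNat : ℕ) := by
      rw [Int.toNat_of_nonneg (sub_nonneg.2 h.le)]; ring
    have := isAndrewsCurtisEquivalent_millerSchuppK_add n k' (k - k').toNat
    rw [← e] at this
    exact this.symm

/-! ### Shehper et al. Thm. 7: `MS(n, w_k) ~ P(n, k)`, and Thm. 4 -/

/-- **Shehper et al. 2025, Thm. 7: `MS(n, w_k)` is Andrews–Curtis equivalent to `P(n, k)`**, for every
`n : ℕ`, `k : ℤ`.  Proof as published: rotate `r₀` to `yⁿ⁻¹xy⁻¹(y⁻¹xyⁿ)⁻¹ = yⁿ⁻ᵏ⁻¹(yᵏxy⁻¹)·((y⁻¹xyᵏ)yⁿ⁻ᵏ)⁻¹`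
and substitute `yᵏxy⁻¹ = x⁻¹yx` and `y⁻¹xyᵏ = xyx⁻¹` (two insertions of conjugates of `r₁^{∓1}`).
[cite: ShehperEtAl2025ACHardRL, Thm 7] -/
theorem isAndrewsCurtisEquivalent_millerSchuppK_shehperP (n : ℕ) (k : ℤ) :
    IsAndrewsCurtisEquivalent (millerSchuppK n k) (shehperP n k) := by
  set x : FreeGroup (Fin 2) := FreeGroup.of 0 with hx
  set y : FreeGroup (Fin 2) := FreeGroup.of 1 with hy
  set v : FreeGroup (Fin 2) := x * (y ^ (-k) * x⁻¹ * y * x * y)⁻¹ with hv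
  have e : millerSchuppK n k = ![x⁻¹ * y ^ n * x * (y ^ (n + 1))⁻¹, v] := rfl
  have fin : shehperP n k = ![y ^ ((n : ℤ) - k - 1) * x⁻¹ * y * x *
      (x * y * x⁻¹ * y ^ ((n : ℤ) - k))⁻¹, v] := rfl
  rw [e, fin]
  -- σ₁ = yⁿ⁻¹ x y⁻⁽ⁿ⁺¹⁾ x⁻¹ y = (y⁻¹x) r₀ (y⁻¹x)⁻¹
  refine (acPair_conj₀ (y⁻¹ * x)
    (u' := y ^ ((n : ℤ) - 1) * x * y ^ (-(n : ℤ) - 1) * x⁻¹ * y) (by group)).trans ?_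
  -- (i): σ₂ = yⁿ⁻ᵏ⁻¹ x⁻¹ y x · y⁻ⁿ x⁻¹ y = σ₁ · D v⁻¹ D⁻¹,  D = y⁻¹ x yⁿ⁺¹ x⁻¹
  refine (acPair_mulConjInv₀ (y⁻¹ * x * y ^ ((n : ℤ) + 1) * x⁻¹)
    (u' := y ^ ((n : ℤ) - k - 1) * x⁻¹ * y * x * y ^ (-(n : ℤ)) * x⁻¹ * y)
    (by rw [hv]; group)).trans ?_
  -- (ii): σ₃ = σ₂ · D' v D'⁻¹,  D' = x y x⁻¹
  exact acPair_mulConj₀ (x * y * x⁻¹) (by rw [hv]; group)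

/-- `P(n, n − 1)` is Andrews–Curtis equivalent to the length-`n + 11` presentation
`⟨x, y ∣ x⁻¹yx = xyx⁻¹y, xyⁿ⁻¹x = yxy⟩` (same first relator; the second relators are cyclic
permutations of each other). [cite: ShehperEtAl2025ACHardRL, Thm 7] -/
theorem isAndrewsCurtisEquivalent_shehperP_shehperT (n : ℕ) :
    IsAndrewsCurtisEquivalent (shehperP n ((n : ℤ) - 1)) (shehperT n) := by
  set x : FreeGroup (Fin 2) := FreeGroup.of 0 with hx
  set y : FreeGroup (Fin 2) := FreeGroup.of 1 with hy
  have e : shehperP n ((n : ℤ) - 1) = ![y ^ ((n : ℤ) - ((n : ℤ) - 1) - 1) * x⁻¹ * y * x *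
      (x * y * x⁻¹ * y ^ ((n : ℤ) - ((n : ℤ) - 1)))⁻¹,
      x * (y ^ (-((n : ℤ) - 1)) * x⁻¹ * y * x * y)⁻¹] := rfl
  have fin : shehperT n = ![x⁻¹ * y * x * (x * y * x⁻¹ * y)⁻¹,
      x * y ^ ((n : ℤ) - 1) * x * (y * x * y)⁻¹] := rfl
  rw [e, fin]
  refine (acPair_conj₀ 1 (u' := x⁻¹ * y * x * (x * y * x⁻¹ * y)⁻¹) (by group)).trans ?_
  exact acPair_conj₁ (x * y ^ ((n : ℤ) - 1)) (by group)

/-! ### Consequences for the Akbulut–Kirby presentations -/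

/-- `AK(n) ~ MS(n, w_k)` for every `k ∈ ℤ` (`n = k₀ + 2`).
[cite: MyasnikovMyasnikovShpilrain2003, Prop 1.3] [cite: ShehperEtAl2025ACHardRL, Thm 6] -/
theorem isAndrewsCurtisEquivalent_akbulutKirby_millerSchuppK (k₀ : ℕ) (k : ℤ) :
    IsAndrewsCurtisEquivalent (akbulutKirby k₀) (millerSchuppK (k₀ + 2) k) :=
  (isAndrewsCurtisEquivalent_akbulutKirby_millerSchuppK_one k₀).trans
    (isAndrewsCurtisEquivalent_millerSchuppK_millerSchuppK (k₀ + 2) 1 k)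

/-- `AK(n) ~ P(n, k)` for every `k ∈ ℤ` (`n = k₀ + 2`). [cite: ShehperEtAl2025ACHardRL, Thm 7] -/
theorem isAndrewsCurtisEquivalent_akbulutKirby_shehperP (k₀ : ℕ) (k : ℤ) :
    IsAndrewsCurtisEquivalent (akbulutKirby k₀) (shehperP (k₀ + 2) k) :=
  (isAndrewsCurtisEquivalent_akbulutKirby_millerSchuppK k₀ k).trans
    (isAndrewsCurtisEquivalent_millerSchuppK_shehperP (k₀ + 2) k)

/-- **Shehper et al. 2025, Thm. 4: `AK(n)` (total length `2n + 7`) is Andrews–Curtis equivalent to the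
presentation `⟨x, y ∣ x⁻¹yx = xyx⁻¹y, xyⁿ⁻¹x = yxy⟩` of total length `n + 11`** (`n = k₀ + 2`).
[cite: ShehperEtAl2025ACHardRL, Thm 4] -/
theorem isAndrewsCurtisEquivalent_akbulutKirby_shehperT (k₀ : ℕ) :
    IsAndrewsCurtisEquivalent (akbulutKirby k₀) (shehperT (k₀ + 2)) := by
  have h := isAndrewsCurtisEquivalent_akbulutKirby_shehperP k₀ ((k₀ : ℤ) + 1)
  have e : ((k₀ : ℤ) + 1) = (((k₀ + 2 : ℕ) : ℤ) - 1) := by push_cast; ring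
  rw [e] at h
  exact h.trans (isAndrewsCurtisEquivalent_shehperP_shehperT (k₀ + 2))

/-- In particular every `MS(n, w_k)`, `P(n, k)` and the length-`n + 11` presentation are Andrews–Curtis
trivial as soon as `AK(n)` is — e.g. for `n = 2` (`AK(2)` is Andrews–Curtis trivial, in the tree as
`Literature.Barriers.SmoothPoincare4.isAndrewsCurtisEquivalent_akbulutKirby_zero_trivial`; stated here
with that fact as a hypothesis to keep this file inside the topic). [cite: ShehperEtAl2025ACHardRL, §3.6] -/
theorem isAndrewsCurtisEquivalent_millerSchuppK_trivial_of_akbulutKirby (k₀ : ℕ) (k : ℤ)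
    (h : IsAndrewsCurtisEquivalent (akbulutKirby k₀) (BalancedPresentation.trivial 2)) :
    IsAndrewsCurtisEquivalent (millerSchuppK (k₀ + 2) k) (BalancedPresentation.trivial 2) :=
  (isAndrewsCurtisEquivalent_akbulutKirby_millerSchuppK k₀ k).symm.trans h

end Literature.Topology.FourManifolds
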